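import Summits.MatrixMultiplication.OmegaCensus.VertexCountingCore
import HarnessLib

/-!
# The law shape from the eight vertex constraints (no parity hypothesis)

ω-census, family (b3).  Framing: lottery ticket; floor = certified bounds/negative ranges.

Companion of `VertexCountingCore.lean`: if the eight vertex constraints hold with total slack exactly `4`
(`3V + 4 = 8N`, the dihedral-like law for `N ≡ 2 (mod 3)`) and `V ≥ 33`, then the size vector is the **law shape**:
two of the three coset-part pairs are `(1,1)` and the third is `(q+1, q)` or `(q, q+1)` with `N = 3q + 2`
(`law_shape_of_vertex_bounds`).  This replaces `parts_law_shape` (`DihedralLawShape.lean`, which needs `N` even) in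
the cyclicity argument, see `DihedralLawAttainedCyclicAll.lean`.
-/

namespace Summit.MatrixMultiplication.OmegaCensus

/-- From `x P = y P + 1` in `ℕ`: `P = 1` and `x = y + 1`. [folklore] -/
theorem eq_one_of_mul_eq_mul_add_one {x y P : ℕ} (h : x * P = y * P + 1) : P = 1 ∧ x = y + 1 := by
  have hd : P ∣ x * P - y * P := Nat.dvd_sub (dvd_mul_left P x) (dvd_mul_left P y)
  have h1 : x * P - y * P = 1 := by omega
  rw [h1, Nat.dvd_one] at hd
  subst hd
  exact ⟨rfl, by omega⟩

/-- **The law shape.** Eight vertex constraints, `V ≥ 33` and slack exactly `4` force, up to the roles of the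
three sets, the size vector `(1,1 | 1,1 | q+1,q)` with `N = 3q+2`. [folklore] -/
theorem law_shape_of_vertex_bounds (N s₀ s₁ t₀ t₁ u₀ u₁ : ℕ)
    (h000 : s₁ * t₀ * u₀ + s₀ * t₁ * u₀ + s₀ * t₀ * u₁ ≤ N) (h111 : s₀ * t₁ * u₁ + s₁ * t₀ * u₁ + s₁ * t₁ * u₀ ≤ N)
    (h100 : s₀ * t₀ * u₀ + s₁ * t₁ * u₀ + s₁ * t₀ * u₁ ≤ N) (h011 : s₁ * t₁ * u₁ + s₀ * t₀ * u₁ + s₀ * t₁ * u₀ ≤ N)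
    (h010 : s₁ * t₁ * u₀ + s₀ * t₀ * u₀ + s₀ * t₁ * u₁ ≤ N) (h101 : s₀ * t₀ * u₁ + s₁ * t₁ * u₁ + s₁ * t₀ * u₀ ≤ N)
    (h001 : s₁ * t₀ * u₁ + s₀ * t₁ * u₁ + s₀ * t₀ * u₀ ≤ N) (h110 : s₀ * t₁ * u₀ + s₁ * t₀ * u₀ + s₁ * t₁ * u₁ ≤ N)
    (hV : 33 ≤ (s₀ + s₁) * (t₀ + t₁) * (u₀ + u₁)) (hlaw : 3 * ((s₀ + s₁) * (t₀ + t₁) * (u₀ + u₁)) + 4 = 8 * N) :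
    (s₀ = 1 ∧ s₁ = 1 ∧ t₀ = 1 ∧ t₁ = 1 ∧
        (u₀ = u₁ + 1 ∧ 2 * u₀ + u₁ = N ∨ u₁ = u₀ + 1 ∧ 2 * u₁ + u₀ = N)) ∨
      (u₀ = 1 ∧ u₁ = 1 ∧ s₀ = 1 ∧ s₁ = 1 ∧
        (t₀ = t₁ + 1 ∧ 2 * t₀ + t₁ = N ∨ t₁ = t₀ + 1 ∧ 2 * t₁ + t₀ = N)) ∨
      (t₀ = 1 ∧ t₁ = 1 ∧ u₀ = 1 ∧ u₁ = 1 ∧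
        (s₀ = s₁ + 1 ∧ 2 * s₀ + s₁ = N ∨ s₁ = s₀ + 1 ∧ 2 * s₁ + s₀ = N)) := by
  have hD : 8 * N ≤ 3 * ((s₀ + s₁) * (t₀ + t₁) * (u₀ + u₁)) + 13 := by omega
  by_cases hs : s₀ = s₁ <;> by_cases ht : t₀ = t₁ <;> by_cases hu : u₀ = u₁
  · -- all balanced: parity contradiction `24 stu + 4 = 8N`
    exfalso
    subst hs; subst ht; subst hu
    have e : (s₀ + s₀) * (t₀ + t₀) * (u₀ + u₀) = 8 * (s₀ * t₀ * u₀) := by ring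
    omega
  · -- `s`, `t` balanced, `u` unbalanced: `U` is the big set
    subst hs; subst ht
    have k1 : u₁ * (s₀ * t₀) + 2 * (u₀ * (s₀ * t₀)) ≤ N := by linarith [h000]
    have k2 : u₀ * (s₀ * t₀) + 2 * (u₁ * (s₀ * t₀)) ≤ N := by linarith [h011]
    have k3 : 12 * (u₀ * (s₀ * t₀)) + 12 * (u₁ * (s₀ * t₀)) + 4 = 8 * N := by linarith [hlaw]
    rcases Nat.lt_or_gt_of_ne hu with hlt | hlt
    · have hab : u₁ * (s₀ * t₀) = u₀ * (s₀ * t₀) + 1 := by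
        have : u₀ * (s₀ * t₀) ≤ u₁ * (s₀ * t₀) := Nat.mul_le_mul_right _ hlt.le
        omega
      have hN : N = 3 * (u₀ * (s₀ * t₀)) + 2 := by omega
      obtain ⟨hP, hu1⟩ := eq_one_of_mul_eq_mul_add_one hab
      rw [hP, mul_one] at hN
      have hs1 := Nat.eq_one_of_mul_eq_one_right hP
      have ht1 := Nat.eq_one_of_mul_eq_one_left hP
      subst hs1; subst ht1
      exact Or.inl ⟨rfl, rfl, rfl, rfl, Or.inr ⟨hu1, by omega⟩⟩
    · have hab : u₀ * (s₀ * t₀) = u₁ * (s₀ * t₀) + 1 := by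
        have : u₁ * (s₀ * t₀) ≤ u₀ * (s₀ * t₀) := Nat.mul_le_mul_right _ hlt.le
        omega
      have hN : N = 3 * (u₁ * (s₀ * t₀)) + 2 := by omega
      obtain ⟨hP, hu1⟩ := eq_one_of_mul_eq_mul_add_one hab
      rw [hP, mul_one] at hN
      have hs1 := Nat.eq_one_of_mul_eq_one_right hP
      have ht1 := Nat.eq_one_of_mul_eq_one_left hP
      subst hs1; subst ht1
      exact Or.inl ⟨rfl, rfl, rfl, rfl, Or.inl ⟨hu1, by omega⟩⟩
  · -- `s`, `u` balanced, `t` unbalanced: `T` is the big set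
    subst hs; subst hu
    have k1 : t₁ * (s₀ * u₀) + 2 * (t₀ * (s₀ * u₀)) ≤ N := by linarith [h000]
    have k2 : t₀ * (s₀ * u₀) + 2 * (t₁ * (s₀ * u₀)) ≤ N := by linarith [h010]
    have k3 : 12 * (t₀ * (s₀ * u₀)) + 12 * (t₁ * (s₀ * u₀)) + 4 = 8 * N := by linarith [hlaw]
    rcases Nat.lt_or_gt_of_ne ht with hlt | hlt
    · have hab : t₁ * (s₀ * u₀) = t₀ * (s₀ * u₀) + 1 := by
        have : t₀ * (s₀ * u₀) ≤ t₁ * (s₀ * u₀) := Nat.mul_le_mul_right _ hlt.le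
        omega
      have hN : N = 3 * (t₀ * (s₀ * u₀)) + 2 := by omega
      obtain ⟨hP, ht1⟩ := eq_one_of_mul_eq_mul_add_one hab
      rw [hP, mul_one] at hN
      have hs1 := Nat.eq_one_of_mul_eq_one_right hP
      have hu1 := Nat.eq_one_of_mul_eq_one_left hP
      subst hs1; subst hu1
      exact Or.inr (Or.inl ⟨rfl, rfl, rfl, rfl, Or.inr ⟨ht1, by omega⟩⟩)
    · have hab : t₀ * (s₀ * u₀) = t₁ * (s₀ * u₀) + 1 := by
        have : t₁ * (s₀ * u₀) ≤ t₀ * (s₀ * u₀) := Nat.mul_le_mul_right _ hlt.le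
        omega
      have hN : N = 3 * (t₁ * (s₀ * u₀)) + 2 := by omega
      obtain ⟨hP, ht1⟩ := eq_one_of_mul_eq_mul_add_one hab
      rw [hP, mul_one] at hN
      have hs1 := Nat.eq_one_of_mul_eq_one_right hP
      have hu1 := Nat.eq_one_of_mul_eq_one_left hP
      subst hs1; subst hu1
      exact Or.inr (Or.inl ⟨rfl, rfl, rfl, rfl, Or.inl ⟨ht1, by omega⟩⟩)
  · -- `s` balanced only
    subst hs
    exact (one_balanced_false N s₀ t₀ t₁ u₀ u₁ ht hu (by linarith) (by linarith) (by linarith) (by linarith)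
      hV hD).elim
  · -- `t`, `u` balanced, `s` unbalanced: `S` is the big set
    subst ht; subst hu
    have k1 : s₁ * (t₀ * u₀) + 2 * (s₀ * (t₀ * u₀)) ≤ N := by linarith [h000]
    have k2 : s₀ * (t₀ * u₀) + 2 * (s₁ * (t₀ * u₀)) ≤ N := by linarith [h100]
    have k3 : 12 * (s₀ * (t₀ * u₀)) + 12 * (s₁ * (t₀ * u₀)) + 4 = 8 * N := by linarith [hlaw]
    rcases Nat.lt_or_gt_of_ne hs with hlt | hlt
    · have hab : s₁ * (t₀ * u₀) = s₀ * (t₀ * u₀) + 1 := by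
        have : s₀ * (t₀ * u₀) ≤ s₁ * (t₀ * u₀) := Nat.mul_le_mul_right _ hlt.le
        omega
      have hN : N = 3 * (s₀ * (t₀ * u₀)) + 2 := by omega
      obtain ⟨hP, hs1⟩ := eq_one_of_mul_eq_mul_add_one hab
      rw [hP, mul_one] at hN
      have ht1 := Nat.eq_one_of_mul_eq_one_right hP
      have hu1 := Nat.eq_one_of_mul_eq_one_left hP
      subst ht1; subst hu1
      exact Or.inr (Or.inr ⟨rfl, rfl, rfl, rfl, Or.inr ⟨hs1, by omega⟩⟩)
    · have hab : s₀ * (t₀ * u₀) = s₁ * (t₀ * u₀) + 1 := by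
        have : s₁ * (t₀ * u₀) ≤ s₀ * (t₀ * u₀) := Nat.mul_le_mul_right _ hlt.le
        omega
      have hN : N = 3 * (s₁ * (t₀ * u₀)) + 2 := by omega
      obtain ⟨hP, hs1⟩ := eq_one_of_mul_eq_mul_add_one hab
      rw [hP, mul_one] at hN
      have ht1 := Nat.eq_one_of_mul_eq_one_right hP
      have hu1 := Nat.eq_one_of_mul_eq_one_left hP
      subst ht1; subst hu1
      exact Or.inr (Or.inr ⟨rfl, rfl, rfl, rfl, Or.inl ⟨hs1, by omega⟩⟩)
  · -- `t` balanced only: roles `(t, u, s)`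
    subst ht
    refine (one_balanced_false N t₀ u₀ u₁ s₀ s₁ hu hs (by linarith) (by linarith) (by linarith) (by linarith)
      ?_ ?_).elim
    · have e : (t₀ + t₀) * (u₀ + u₁) * (s₀ + s₁) = (s₀ + s₁) * (t₀ + t₀) * (u₀ + u₁) := by ring
      rw [e]; exact hV
    · have e : (t₀ + t₀) * (u₀ + u₁) * (s₀ + s₁) = (s₀ + s₁) * (t₀ + t₀) * (u₀ + u₁) := by ring
      rw [e]; exact hD
  · -- `u` balanced only: roles `(u, s, t)`
    subst hu
    refine (one_balanced_false N u₀ s₀ s₁ t₀ t₁ hs ht (by linarith) (by linarith) (by linarith) (by linarith)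
      ?_ ?_).elim
    · have e : (u₀ + u₀) * (s₀ + s₁) * (t₀ + t₁) = (s₀ + s₁) * (t₀ + t₁) * (u₀ + u₀) := by ring
      rw [e]; exact hV
    · have e : (u₀ + u₀) * (s₀ + s₁) * (t₀ + t₁) = (s₀ + s₁) * (t₀ + t₁) * (u₀ + u₀) := by ring
      rw [e]; exact hD
  · exact (unbalanced_false N s₀ s₁ t₀ t₁ u₀ u₁ hs ht hu h000 h111 h100 h011 h010 h101 h001 h110 hV hD).elim

end Summit.MatrixMultiplication.OmegaCensus
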